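import Summits.Ventures.YMGap.RobustBall.RobustStarArray
import Summits.Ventures.YMGap.RobustBall.StarGaugePerturbed
import HarnessLib

/-!
# Venture YMGap, track ROBUST-BALL (Y2) — crux Y2-X2 for the FULL tier-1 ball, step 3b: the ROBUST
# one-sided comparison (gauge fixed at one star link) for the perturbed star kernels

HONEST FRAMING. WHAT THIS IS: a venture file (cell `pub-ymgap`, track Y2 ROBUST-BALL, seat ds-2):
ds-4's gauge-fixed Lemma-G comparison (`StarLemmaGWeight.oneSided`, `star_isLinkWindowContraction`) RUN
FOR THE PERTURBED TORUS SPECIFICATION `perturbedTorusSpec W β` of a member `W` of the ball, whose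
single-link Dobrushin matrix is the ROBUST one, `Cst c E x z = c · tInfluence x z + E x z` with OFF-COLUMN
entries `E` (polymers larger than a plaquette — the open part of crux Y2-X2). Mechanism: gauge average at the
centre and freezing of a star link hold for the perturbed specification (`StarGaugePerturbed`); Föllmer's
comparison with boundary (`DobrushinComparisonBoundary.abs_kernel_sub_le_of_superSolution`) is run with the
super-solution `dvec + U`, `dvec` = ds-4's explicit Lemma-G super-solution at `c`, `U` = the Neumann-iterate
super-solution (`StarNeumann.superSol`) of the in-star matrix applied to the source `E · dvec`
(`RobustStar.wone`); for boundary links off the plaquette boundary of the star only `U` is present.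
Output: `oneSided_robust` (this file); the far case and the window contraction (H1) with the robust array
`Krob = Karr c + Uarr` are `RobustStarWindow.lean`. WHAT THIS IS NOT: no received sum (that is
`RobustStarReceivedSum`), no clustering statement, no number; strong-coupling LATTICE bookkeeping on finite
tori — nothing about the continuum or the Millennium problem.

## References
* H. Föllmer, LNM 1362 (1988) Ch. I (2.7)–(2.10); R. L. Dobrushin, S. B. Shlosman (1985).
* The tree: `Thresholds/StarWindowBoundWeight.lean` (ds-4; followed step by step), `StarLemmaGSuperSolutionDim`,
  `Literature/Probability/LatticeModels/DobrushinComparisonBoundary.lean`.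
-/

noncomputable section

open MeasureTheory Function Finset
open Literature.Probability.LatticeModels
open Literature.Probability.LatticeModels.DobrushinMetric
open Literature.MathematicalPhysics.QuantumFieldTheory hiding ZdEdge
open Literature.MathematicalPhysics.QuantumFieldTheory.Balaban1983to89.StrongCouplingTorusWindow
open Summit.Ventures.YMGap.DSWindow
open Summit.Ventures.YMGap.StarKernel
open Summit.Ventures.YMGap.StarResolventDim (Delta gaugeR)
open Summit.Ventures.YMGap.StarLemmaGDim
open Summit.Ventures.YMGap.StarLemmaGSUN (suFrobDist_mul_mul)
open Summit.Ventures.YMGap.StarNeumann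
open Summit.Ventures.YMGap.RobustBall

namespace Summit.Ventures.YMGap.RobustStar

variable {d L N : ℕ} [NeZero L]

/-! ### Two adapters -/

/-- `∑_{z ≠ x} tInfluence x z · w z = ∑_{z ∈ linkNbrT x} tInfluence x z · w z` (the count vanishes off the
plaquette neighbours). [folklore] -/
theorem sum_erase_tInfluence_mul_eq (hL : 1 < L) (x : Edge d L) (w : Edge d L → ℝ) :
    ∑ z ∈ univ.erase x, (tInfluence x z : ℝ) * w z = ∑ z ∈ linkNbrT x, (tInfluence x z : ℝ) * w z := by
  rw [sum_linkNbrT_tInfluence_mul hL x w]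
  exact sum_congr rfl fun z hz => by rw [tInfluence_eq_jointPlaq hL (mem_erase.1 hz).1]

/-- A star link shares no plaquette with a link off the star and off the star boundary. [folklore] -/
theorem tInfluence_eq_zero_of_not_mem_starBoundary (hL : 1 < L) {s : Site d L} {x y : Edge d L}
    (hx : x ∈ vertexStar s) (hy : y ∉ vertexStar s) (hyb : y ∉ starBoundary s) : (tInfluence x y : ℝ) = 0 := by
  have hyx : y ≠ x := fun h => hy (h ▸ hx)
  rw [tInfluence_eq_jointPlaq hL hyx]
  have h : jointPlaq x y = 0 := by
    rw [jointPlaq_eq_zero_iff]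
    intro q hxq hyq
    exact hyb (mem_starBoundary.2 ⟨⟨q, mem_starPlaqs.2 ⟨x, hxq, hx⟩, hyq⟩, hy⟩)
  rw [h, Nat.cast_zero]

/-- `∑_{z ≠ x} Cst x z · U z = ∑_{z ∈ ⋆∖x} Cst x z · U z` for `U` vanishing off the star. [folklore] -/
theorem sum_erase_mul_eq_sum_star {s : Site d L} (x : Edge d L) (g U : Edge d L → ℝ)
    (hU : ∀ z, z ∉ vertexStar s → U z = 0) :
    ∑ z ∈ univ.erase x, g z * U z = ∑ z ∈ (vertexStar s).erase x, g z * U z := by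
  symm
  refine sum_subset (erase_subset_erase _ (subset_univ _)) fun z hz hz' => ?_
  have hzs : z ∉ vertexStar s := fun h => hz' (mem_erase.2 ⟨(mem_erase.1 hz).1, h⟩)
  rw [hU z hzs, mul_zero]

variable {W : Perturbation d L N} {β c θ : ℝ} {E : Edge d L → Edge d L → ℝ}

/-! ### The robust one-sided comparison (gauge fixed at `a`) -/

/-- **Robust one-sided bound (gauge fixed at `a`).** Star plaquette `q` of `s` with star links `a ≠ b`,
boundary link `y ∈ q` off the star, `ω = η` off `y`, `f` a bounded measurable observable of the star links
with per-link Lipschitz vector `δ ≥ 0` for `suFrobDist`; the perturbed specification of the member `W` at tree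
coupling `β` is assumed to have single-link Dobrushin coefficients `Cst c E = c · tInfluence + E`
(`c ≥ 0` below the pole, `E ≥ 0`) with in-star rows `≤ θ < 1`. Then
`|∫ f dγ_⋆(ω) − ∫ f dγ_⋆(η)| ≤ d_F(ω_y, η_y) · Σ_{x ∈ ⋆} (c · kside c s a b x + U^{ab}_x) δ_x`, where
`U^{ab} = superSol (Cst c E) ⋆ (wone c E s y a b) θ (2 Msrc c E s y) K` is the Neumann correction of the
one-sided source: gauge-average `f` at `s`, freeze `a`, compare the two frozen kernels on `⋆ ∖ {a}` by
Föllmer's comparison with the super-solution `dvec + U^{ab}`. [folklore] -/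
theorem oneSided_robust (hd : 2 ≤ d) (hL : 3 ≤ L) (hc : 0 ≤ c) (hΔ : 0 < Delta d c)
    (hE : ∀ x z, 0 ≤ E x z) (hθ0 : 0 ≤ θ) (hθ1 : θ < 1)
    (hrow : ∀ (s : Site d L), ∀ x ∈ vertexStar s, ∑ z ∈ (vertexStar s).erase x, Cst c E x z ≤ θ)
    (hK : IsKRContraction (perturbedTorusSpec W β) suFrobDist (fun e => univ.erase e) (Cst c E)) (K : ℕ)
    {s : Site d L} {q : Plaquette d L} (hq : q ∈ starPlaqs s) {y : Edge d L} (hyq : y ∈ plaqEdgesT q)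
    (hy : y ∉ vertexStar s) {a b : Edge d L} (ha : a ∈ vertexStar s) (haq : a ∈ plaqEdgesT q)
    (hb : b ∈ vertexStar s) (hbq : b ∈ plaqEdgesT q) (hab : a ≠ b)
    {ω η : GaugeConfig d L (SUN N)} (hωη : ∀ e, e ≠ y → ω e = η e)
    {f : GaugeConfig d L (SUN N) → ℝ} (hfm : Measurable f) {B : ℝ} (hB : ∀ U, |f U| ≤ B)
    (hfdep : DependsOn f (↑(vertexStar s) : Set (Edge d L))) {δ : Edge d L → ℝ} (hδ0 : ∀ x, 0 ≤ δ x)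
    (hlip : ∀ (x : Edge d L) (σ τ : GaugeConfig d L (SUN N)), (∀ e, e ≠ x → σ e = τ e) →
      |f σ - f τ| ≤ δ x * suFrobDist (σ x) (τ x)) :
    |∫ U, f U ∂(perturbedTorusSpec W β (vertexStar s) ω) - ∫ U, f U ∂(perturbedTorusSpec W β (vertexStar s) η)| ≤
      suFrobDist (ω y) (η y) * ∑ x ∈ vertexStar s,
        (c * kside c s a b x + superSol (Cst c E) (vertexStar s) (wone c E s y a b) θ (2 * Msrc c E s y) K x) * δ x := by
  classical
  haveI : SecondCountableTopology (Matrix (Fin N) (Fin N) ℂ) :=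
    inferInstanceAs (SecondCountableTopology (Fin N → Fin N → ℂ))
  haveI : SecondCountableTopology (SUN N) := Topology.IsEmbedding.subtypeVal.secondCountableTopology
  have hL1 : 1 < L := by omega
  have hΛ : ∀ e : Edge d L, (e.1 = s ∨ e.1.shift e.2 = s) → e ∈ vertexStar s := fun e he => mem_vertexStar_iff'.2 he
  have ha' : a.1 = s ∨ a.1.shift a.2 = s := mem_vertexStar_iff'.1 ha
  have hya : y ≠ a := fun h => hy (h ▸ ha)
  set γ := perturbedTorusSpec W β with hγdef
  have hγ : IsSpecification γ := isSpecification_perturbedTorusSpec W β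
  -- Step 1: gauge average at `s`
  set fb := StarGauge.gaugeAvg s f with hfb
  have hfbm : Measurable fb := StarGauge.measurable_gaugeAvg s hfm
  have hfbB : ∀ U, |fb U| ≤ B := StarGauge.abs_gaugeAvg_le s hB
  have hfbdep : DependsOn fb (↑(vertexStar s) : Set (Edge d L)) := StarGauge.dependsOn_gaugeAvg s hfdep
  have hfbinv : ∀ (g : SUN N) (U : GaugeConfig d L (SUN N)),
      fb (gaugeTransform (StarGauge.gaugeAt s g) U) = fb U := StarGauge.gaugeAvg_gaugeTransform_gaugeAt s f
  have hfblip : ∀ (x : Edge d L) (σ τ : GaugeConfig d L (SUN N)), (∀ e, e ≠ x → σ e = τ e) →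
      |fb σ - fb τ| ≤ δ x * suFrobDist (σ x) (τ x) :=
    StarGauge.lip_gaugeAvg s suFrobDist_mul_mul hfm hB hlip
  rw [perturbed_integral_sub_integral_eq_gaugeAvg W β hΛ ω η hfm hB]
  -- Step 2: freeze the link `a`
  rw [integral_perturbedTorusSpec_eq_erase W β hL1 hΛ ha' ω hfbm hfbB hfbinv,
    integral_perturbedTorusSpec_eq_erase W β hL1 hΛ ha' η hfbm hfbB hfbinv]
  -- Step 3: under the frozen kernels `fb = F := fb ∘ (update · a 1)` almost surely
  set Λ' := (vertexStar s).erase a with hΛ'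
  set F : GaugeConfig d L (SUN N) → ℝ := fun U => fb (update U a 1) with hF
  have step3 : ∀ ζ : GaugeConfig d L (SUN N),
      ∫ U, fb U ∂(γ Λ' (update ζ a 1)) = ∫ U, F U ∂(γ Λ' (update ζ a 1)) := by
    intro ζ
    refine integral_congr_ae ?_
    filter_upwards [hγ.proper Λ' (update ζ a 1)] with U hU
    have hUa : U a = 1 := by rw [hU a (notMem_erase a _), update_self]
    show fb U = fb (update U a 1)
    rw [← hUa, update_eq_self]
  rw [step3 ω, step3 η]
  -- Step 4: Föllmer's comparison on `Λ'` with the super-solution `dvec + U`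
  have hyΛ' : y ∉ Λ' := fun h => hy (mem_of_mem_erase h)
  have hω'η' : ∀ z, z ≠ y → update ω a 1 z = update η a 1 z := by
    intro z hz
    by_cases hza : z = a
    · subst hza; simp
    · rw [update_of_ne hza, update_of_ne hza, hωη z hz]
  have hFm : Measurable F :=
    hfbm.comp (measurable_update' (a := a) |>.comp (measurable_id.prodMk measurable_const))
  have hFB : ∀ U, |F U| ≤ B := fun U => hfbB _
  have hFdep : DependsOn F (↑Λ' : Set (Edge d L)) := by
    intro U U' hUU'
    show fb (update U a 1) = fb (update U' a 1)
    refine hfbdep fun e he => ?_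
    by_cases hea : e = a
    · subst hea; simp
    · rw [update_of_ne hea, update_of_ne hea]
      exact hUU' e (Finset.mem_coe.2 (mem_erase.2 ⟨hea, Finset.mem_coe.1 he⟩))
  set δ' : Edge d L → ℝ := fun z => if z = a then 0 else δ z with hδ'
  have hFlip : IsLipBound suFrobDist F δ' := by
    refine ⟨fun z => by simp only [hδ']; split_ifs; exacts [le_rfl, hδ0 z], fun z σ τ hστ => ?_⟩
    show |fb (update σ a 1) - fb (update τ a 1)| ≤ δ' z * suFrobDist (σ z) (τ z)
    by_cases hza : z = a
    · subst hza
      have hst : update σ z 1 = update τ z 1 := by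
        funext e
        by_cases hez : e = z
        · subst hez; simp
        · rw [update_of_ne hez, update_of_ne hez, hστ e hez]
      rw [hst, sub_self, abs_zero]
      simp [hδ']
    · have h := hfblip z (update σ a 1) (update τ a 1) (fun e hez => by
        by_cases hea : e = a
        · subst hea; simp
        · rw [update_of_ne hea, update_of_ne hea, hστ e hez])
      rw [update_of_ne hza, update_of_ne hza] at h
      simpa only [hδ', if_neg hza] using h
  -- the Neumann correction
  set U : Edge d L → ℝ := superSol (Cst c E) (vertexStar s) (wone c E s y a b) θ (2 * Msrc c E s y) K with hUdef
  have hU0 : ∀ z, 0 ≤ U z := fun z =>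
    superSol_nonneg (Cst_nonneg hc hE) (wone_nonneg hd hc hΔ hE s y a b) hθ0 hθ1
      (mul_nonneg zero_le_two (Msrc_nonneg hd hc hΔ hE s y)) K z
  have hUoff : ∀ z, z ∉ vertexStar s → U z = 0 := fun z hz => superSol_of_not_mem _ _ _ _ _ hz
  have hM : ∀ x ∈ vertexStar s, wone c E s y a b x ≤ 2 * Msrc c E s y := fun x hx =>
    (wone_le_two_mul_wsrc hd hc hΔ hE hq hyq hy ha haq hb hbq hab hx).trans
      (mul_le_mul_of_nonneg_left (wsrc_le_Msrc hd hc hΔ hE s y hx) zero_le_two)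
  have hM0 : 0 ≤ 2 * Msrc c E s y := mul_nonneg zero_le_two (Msrc_nonneg hd hc hΔ hE s y)
  -- the super-solution property of `dvec + U` on `Λ'`
  have hsol : ∀ x ∈ Λ', ∑ z ∈ univ.erase x, Cst c E x z * (dvec c s y a b z + U z) ≤ dvec c s y a b x + U x := by
    intro x hx
    have hxs : x ∈ vertexStar s := mem_of_mem_erase hx
    have hsplit : ∑ z ∈ univ.erase x, Cst c E x z * (dvec c s y a b z + U z) =
        ∑ z ∈ univ.erase x, c * (tInfluence x z : ℝ) * dvec c s y a b z +
          ∑ z ∈ univ.erase x, E x z * dvec c s y a b z + ∑ z ∈ univ.erase x, Cst c E x z * U z := by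
      rw [← sum_add_distrib, ← sum_add_distrib]
      exact sum_congr rfl fun z _ => by simp only [Cst]; ring
    rw [hsplit]
    -- (i) the Wilson part: ds-4's super-solution
    have h1 : ∑ z ∈ univ.erase x, c * (tInfluence x z : ℝ) * dvec c s y a b z ≤ dvec c s y a b x := by
      have hre : ∑ z ∈ univ.erase x, c * (tInfluence x z : ℝ) * dvec c s y a b z =
          ∑ z ∈ linkNbrT x, c * (tInfluence x z : ℝ) * dvec c s y a b z := by
        have h := sum_erase_tInfluence_mul_eq hL1 x (fun z => c * dvec c s y a b z)
        simp_rw [← mul_assoc] at h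
        rw [show (∑ z ∈ univ.erase x, c * (tInfluence x z : ℝ) * dvec c s y a b z) =
            ∑ z ∈ univ.erase x, (tInfluence x z : ℝ) * c * dvec c s y a b z from
            sum_congr rfl fun z _ => by ring, h]
        exact sum_congr rfl fun z _ => by ring
      rw [hre]
      exact dvec_superSolution hL hc hΔ hq hyq hy ha haq hb hbq hab hx
    -- (ii) the source and (iii) the Neumann correction
    have h3 : wone c E s y a b x + ∑ z ∈ univ.erase x, Cst c E x z * U z ≤ U x := by
      rw [sum_erase_mul_eq_sum_star x (Cst c E x) U hUoff]
      exact superSol_isSuperSolution (Cst_nonneg hc hE) hθ0 hθ1 (hrow s) hM hM0 K hxs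
    have h2 : ∑ z ∈ univ.erase x, E x z * dvec c s y a b z = wone c E s y a b x := rfl
    linarith
  have hrowW : ∀ x ∈ Λ', ∑ z ∈ univ.erase x, (if z ∈ Λ' then Cst c E x z else 0) ≤ θ := by
    intro x hx
    have hxs : x ∈ vertexStar s := mem_of_mem_erase hx
    calc ∑ z ∈ univ.erase x, (if z ∈ Λ' then Cst c E x z else 0)
        ≤ ∑ z ∈ univ.erase x, (if z ∈ vertexStar s then Cst c E x z else 0) :=
          sum_le_sum fun z _ => by
            by_cases hz : z ∈ Λ'
            · rw [if_pos hz, if_pos (mem_of_mem_erase hz)]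
            · rw [if_neg hz]; split_ifs; exacts [Cst_nonneg hc hE x z, le_rfl]
      _ = ∑ z ∈ (vertexStar s).erase x, Cst c E x z := by
          rw [← sum_filter]
          exact sum_congr (by ext z; simp [mem_erase, and_comm]) fun _ _ => rfl
      _ ≤ θ := hrow s x hxs
  have key := abs_kernel_sub_le_of_superSolution hγ hK (fun p q => suFrobDist_nonneg p q)
    (fun p q => suFrobDist_le p q) (R := 2 * Real.sqrt N) (by positivity) Λ' hyΛ' hω'η'
    (d := fun z => dvec c s y a b z + U z) (fun z => add_nonneg (dvec_nonneg hd hc hΔ s y a b z) (hU0 z))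
    (by simp only [dvec, if_true]; linarith [hU0 y]) hsol hθ0 hθ1 hrowW hFm hFdep hFB hFlip
  rw [update_of_ne hya, update_of_ne hya] at key
  refine key.trans (mul_le_mul_of_nonneg_left ?_ (suFrobDist_nonneg _ _))
  -- compare the sums: on `Λ'`, `dvec = c · kside` and `δ' = δ`; the `a`-term on the right is nonnegative
  have hterm : ∀ z ∈ Λ', (dvec c s y a b z + U z) * δ' z = (c * kside c s a b z + U z) * δ z := by
    intro z hz
    obtain ⟨hza, hzs⟩ := mem_erase.1 hz
    have hzy : z ≠ y := fun h => hy (h ▸ hzs)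
    simp only [dvec, if_neg hzy, if_pos hzs, hδ', if_neg hza]
  rw [sum_congr rfl hterm, hΛ']
  have haterm : 0 ≤ (c * kside c s a b a + U a) * δ a :=
    mul_nonneg (add_nonneg (mul_nonneg hc (kside_nonneg hd hc hΔ s a b a)) (hU0 a)) (hδ0 a)
  rw [← add_sum_erase _ _ ha]
  linarith

end Summit.Ventures.YMGap.RobustStar

end
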